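import Summits.HubbardSuperconductivity.HubbardSuperconductivity.Theorems.BalabanIRBirComplexStableXYRStubSectorModulusFat
import Literature.MathematicalPhysics.QuantumFieldTheory.TorusChartCochains
import HarnessLib

/-!
# Route `BalabanIR`, crux `BirComplexStableXYR` (item `stmt-HubbardSuperconductivity-14845`),
# line `fat-gaussian-defect-calculus`: stub `stub_sectorIntegrandExact`

Helper (`--supports`) for the crux
`Summit.HubbardSuperconductivity.HubbardSuperconductivity.Theses.BalabanIR.BirComplexStableXYR`,
line `fat-gaussian-defect-calculus` (lead skeleton `Cruxes/BirComplexStableXYR/Lines/fat_gaussian_defect_calculus.lean`),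
stub `stub_sectorIntegrandExact`: **the Gaussian splitting of the R9 sector representation is an exact rewriting
of the Gibbs factor — the product collapses back to `Π_s exp(−K F(ψ_s))`.**

**Statement.** On the space–time torus `Λ L M` (chart `TorusChart.piProdZMod 2 L M`), for a window table
`c : Table r` and `K : ℝ`, let `P ω s` be the window path configurations of a real `1`-cochain `ω`
(hypothesis `hP`), `Q` the window Hessian form (hypothesis `hQ`), `𝒬(ω) = Σ_s Q (P ω s)` the thin form, and let
the strain `σ` satisfy Pythagoras `𝒬(d₀u − σ) = 𝒬(d₀u) + 𝒬(σ)` for all real fields `u`.  Then for every `u`,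
writing `ψ_s = P (d₀u − σ) s` and `F = genF c`,

  `e^{−(K/2)𝒬(σ)} · (e^{−(K/2)𝒬(d₀u)} · Π_s exp(−K F(ψ_s) + (K/2) Q(ψ_s))) = Π_s exp(−K F(ψ_s))`.

**Proof.** Each local factor splits (`Complex.exp_add`) as `exp(−K F(ψ_s)) · exp((K/2) Q(ψ_s))`; the product
distributes (`Finset.prod_mul_distrib`), the `Q`-exponentials recombine (`Complex.exp_sum` reversed) to
`exp((K/2) Σ_s Q(ψ_s)) = exp((K/2)(𝒬(d₀u) + 𝒬(σ)))` by Pythagoras, and the three scalar exponentials multiply to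
`exp 0 = 1`.  The abstract finite-product core is `hsc_integrandExactCore`; the defining hypotheses `hP`, `hQ` are
not used.  Elementary; no definition and no named fact is introduced; sorry-free. [folklore]
-/

set_option linter.dupNamespace false -- `Summit.<S>.<S>.Theorems…` repeats the summit name (D-0017 layout)

namespace Summit.HubbardSuperconductivity.HubbardSuperconductivity.Theorems.FSUnfolding

open scoped BigOperators ComplexConjugate
open Literature.MathematicalPhysics.QuantumFieldTheory Literature.Probability.LatticeModels
open Summit.HubbardSuperconductivity.BirComplexStableXYNegative

/-- **Abstract core of `stub_sectorIntegrandExact`.**  If the real exponents satisfy Pythagoras `Σ_s q_s = B + A`,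
then `e^{−(K/2)A} (e^{−(K/2)B} Π_s exp(−K G_s + (K/2) q_s)) = Π_s exp(−K G_s)`: each factor splits as
`exp(−K G_s) · exp((K/2) q_s)`, the `q`-exponentials recombine to `exp((K/2)(B + A))`, and this cancels the two
prefactors exactly. [folklore] -/
theorem hsc_integrandExactCore {S : Type*} [Fintype S] (K A B : ℝ) (G : S → ℂ) (q : S → ℝ)
    (hpy : ∑ s, q s = B + A) :
    Complex.exp (-(((K / 2 * A) : ℝ) : ℂ)) * (Complex.exp (-(((K / 2 * B) : ℝ) : ℂ)) *
      ∏ s, Complex.exp (-((K : ℂ) * G s) + (((K / 2 * q s) : ℝ) : ℂ))) =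
    ∏ s, Complex.exp (-((K : ℂ) * G s)) := by
  -- each local factor splits: `exp(−K G_s + (K/2) q_s) = exp(−K G_s) · exp((K/2) q_s)`
  have hsplit : ∏ s, Complex.exp (-((K : ℂ) * G s) + (((K / 2 * q s) : ℝ) : ℂ))
      = (∏ s, Complex.exp (-((K : ℂ) * G s))) * ∏ s, Complex.exp (((K / 2 * q s) : ℝ) : ℂ) := by
    rw [← Finset.prod_mul_distrib]
    exact Finset.prod_congr rfl fun s _ => Complex.exp_add _ _
  -- the `q`-exponentials recombine and Pythagoras evaluates the sum
  have hq : ∏ s, Complex.exp (((K / 2 * q s) : ℝ) : ℂ) = Complex.exp (((K / 2 * (B + A)) : ℝ) : ℂ) := by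
    rw [← Complex.exp_sum, ← Complex.ofReal_sum, ← Finset.mul_sum, hpy]
  -- the three scalar exponentials cancel exactly
  have hcancel : Complex.exp (-(((K / 2 * A) : ℝ) : ℂ)) * Complex.exp (-(((K / 2 * B) : ℝ) : ℂ)) *
      Complex.exp (((K / 2 * (B + A)) : ℝ) : ℂ) = 1 := by
    rw [← Complex.exp_add, ← Complex.exp_add,
      show -(((K / 2 * A : ℝ)) : ℂ) + -(((K / 2 * B : ℝ)) : ℂ) + ((K / 2 * (B + A) : ℝ) : ℂ) = 0 by
        push_cast; ring,
      Complex.exp_zero]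
  calc Complex.exp (-(((K / 2 * A) : ℝ) : ℂ)) * (Complex.exp (-(((K / 2 * B) : ℝ) : ℂ)) *
          ∏ s, Complex.exp (-((K : ℂ) * G s) + (((K / 2 * q s) : ℝ) : ℂ)))
        = (Complex.exp (-(((K / 2 * A) : ℝ) : ℂ)) * Complex.exp (-(((K / 2 * B) : ℝ) : ℂ)) *
            Complex.exp (((K / 2 * (B + A)) : ℝ) : ℂ)) * ∏ s, Complex.exp (-((K : ℂ) * G s)) := by
          rw [hsplit, hq]; ring
    _ = ∏ s, Complex.exp (-((K : ℂ) * G s)) := by rw [hcancel, one_mul]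

/-- **Stub `stub_sectorIntegrandExact` (registered signature, verbatim): the Gaussian splitting of the R9 sector
representation is an exact rewriting of the Gibbs factor.**  For ANY strain `σ` with the Pythagoras property and
any real field `u`, the full R9 sector integrand (prefactor `e^{−(K/2)𝒬(σ)}`, thin Gaussian `e^{−(K/2)𝒬(d₀u)}`,
local factors `Π_s R_s(P_s(d₀u − σ))`, `R_s(ψ) = exp(−K genF c ψ + (K/2) Q ψ)`) EQUALS the bare Gibbs product
`Π_s exp(−K genF c (P_s(d₀u − σ)))`: `Σ_s Q(P_s(d₀u − σ)) = 𝒬(d₀u) + 𝒬(σ)` cancels the Gaussian exponents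
exactly (`hsc_integrandExactCore`). [folklore] -/
theorem stub_sectorIntegrandExact :
    ∀ (r : ℕ) (K : ℝ) (c : Table r) (L M : ℕ) [NeZero L] [NeZero M]
      (P : (Λ L M → Fin 3 → ℝ) → Λ L M → W r → ℝ),
      (∀ (ω : Λ L M → Fin 3 → ℝ) (s : Λ L M) (w : W r), P ω s w =
        (TorusChart.piProdZMod 2 L M).lineSum ω 0 (w.1 : ℕ) s
          + (TorusChart.piProdZMod 2 L M).lineSum ω 1 (w.2.1 : ℕ) (s + (w.1 : ℕ) • (TorusChart.piProdZMod 2 L M).gen 0)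
          + (TorusChart.piProdZMod 2 L M).lineSum ω 2 (w.2.2 : ℕ)
            (s + (w.1 : ℕ) • (TorusChart.piProdZMod 2 L M).gen 0 + (w.2.1 : ℕ) • (TorusChart.piProdZMod 2 L M).gen 1)) →
      ∀ (Q : (W r → ℝ) → ℝ),
      (∀ u : W r → ℝ, Q u = (-c.sum (fun n a => a * (((∑ w, (n w : ℝ) * u w) ^ 2 : ℝ) : ℂ))).re) →
      ∀ (σ : Λ L M → Fin 3 → ℝ),
        (∀ u : Λ L M → ℝ,
          ∑ s : Λ L M, Q (P (fun x i => (TorusChart.piProdZMod 2 L M).d₀ u x i - σ x i) s) =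
            ∑ s : Λ L M, Q (P ((TorusChart.piProdZMod 2 L M).d₀ u) s) + ∑ s : Λ L M, Q (P σ s)) →
      ∀ (u : Λ L M → ℝ),
        Complex.exp (-(((K / 2 * ∑ s : Λ L M, Q (P σ s)) : ℝ) : ℂ)) *
          (Complex.exp (-(((K / 2 * ∑ s : Λ L M, Q (P ((TorusChart.piProdZMod 2 L M).d₀ u) s)) : ℝ) : ℂ)) *
            ∏ s : Λ L M, Complex.exp
              (-((K : ℂ) * genF c (P (fun x i => (TorusChart.piProdZMod 2 L M).d₀ u x i - σ x i) s))
                + (((K / 2 * Q (P (fun x i => (TorusChart.piProdZMod 2 L M).d₀ u x i - σ x i) s)) : ℝ) : ℂ))) =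
          ∏ s : Λ L M, Complex.exp
            (-((K : ℂ) * genF c (P (fun x i => (TorusChart.piProdZMod 2 L M).d₀ u x i - σ x i) s))) := by
  intro r K c L M _ _ P _hP Q _hQ σ hpyth u
  exact hsc_integrandExactCore K (∑ s : Λ L M, Q (P σ s))
    (∑ s : Λ L M, Q (P ((TorusChart.piProdZMod 2 L M).d₀ u) s))
    (fun s => genF c (P (fun x i => (TorusChart.piProdZMod 2 L M).d₀ u x i - σ x i) s))
    (fun s => Q (P (fun x i => (TorusChart.piProdZMod 2 L M).d₀ u x i - σ x i) s)) (hpyth u)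

end Summit.HubbardSuperconductivity.HubbardSuperconductivity.Theorems.FSUnfolding
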